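import Mathlib.Tactic.Linarith
import Summits.CriticalPhenomena.PercolationContinuityZ3.Theorems.PercNearOneGluingNoHeavyLowerTailSahiCTCNcSplitNested
import HarnessLib

/-!
# `NoHeavyLowerTail` (crux stmt-CriticalPhenomena-4575), P3 lane: the MOVES of the level-split form `T_c` — how `T_c(K_X,K_Z)` changes when one
# face is removed from `K_X` (big face: no change; private small face: `+ e_c·r^F·h_Z`; common face below level `c`: `− e_c·r^F·(Π − h_Z)`),
# hence the reduction of (LS_c) for `T_c` to SATURATED pairs without common sub-top maximal faces

Support file (seat `prim-l12-p3`, gen 23; `--supports stmt-CriticalPhenomena-4575`).  Memo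
`run/shared/lean/prim/prim-l12/FROM-prim-l12-p3-g23-LEVEL-SPLIT.md` §1.2.  Companion of `…SahiCTCNcSplit` (`T_c = e_c·(Π·h_Y − h_X·h_Z) −
Θ_c·D_c·e_Y`) and of the antitonicity file `…SahiCTCNcGen` (the same moves for `Ñ_c`).

For a family `K_X`, a second family `K_Z` and a set `F ∈ K_X`:
* `TcForm_erase_big`     : `#F > c`                ⇒ `T_c(K_X∖F, K_Z) = T_c(K_X, K_Z)` (`T_c` only sees the `c`-skeleta);
* `TcForm_erase_private` : `#F ≤ c`, `F ∉ K_Z`      ⇒ `T_c(K_X∖F, K_Z) = T_c(K_X, K_Z) + e_c·r^F·h_Z` — removing a PRIVATE small face RAISES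
  `T_c` (so `T_c` is smallest on pairs saturated with private faces, exactly like `Ñ_c`, `coeff_TcForm_le_erase_private`);
* `TcForm_erase_common_lt` : `#F < c`, `F ∈ K_Z`    ⇒ `T_c(K_X∖F, K_Z) = T_c(K_X, K_Z) − e_c·r^F·(Π − h_Z)` — removing a COMMON face BELOW the
  top level LOWERS `T_c` (`coeff_TcForm_erase_common_lt_le`), so to prove `T_c(K_X,K_Z) ∈ ℕ[r]` one may first delete from `K_X` every common
  face of size `< c` that is maximal in `K_X` (the pair stays a pair of down-sets) — the analogue for `T_c` of "common minimal sets of size ≥ 3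
  may be removed" in the dual picture of memo §3.
No positivity of `T_c` is claimed here; nothing is asserted about the crux.
-/

namespace Summit.CriticalPhenomena.PercolationContinuityZ3.Theorems.SahiCTCForms

open Finset MvPolynomial SahiCTCGenFun

variable {α : Type*} [DecidableEq α] [Fintype α]

/-! ### Big faces are invisible to `T_c` -/

/-- Removing a face of size `> c` does not change `T_c`. [this work] -/
theorem TcForm_erase_big {c : ℕ} {K KZ : Finset (Finset α)} {F : Finset α} (hF : c < #F) :
    TcForm c (K.erase F) KZ = TcForm c K KZ := by
  obtain ⟨h3, h4⟩ := commonFamilies_erase_big (K := K) (KZ := KZ) hF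
  unfold TcForm
  rw [facesLE_erase_big hF, h3, h4]

/-! ### Private small faces: removal raises `T_c` -/

/-- **Private move**: for `F ∈ K_X` with `#F ≤ c` and `F ∉ K_Z`, `T_c(K_X∖F, K_Z) = T_c(K_X, K_Z) + e_c·r^F·h_Z`. [this work] -/
theorem TcForm_erase_private {c : ℕ} {K KZ : Finset (Finset α)} {F : Finset α} (hFK : F ∈ K) (hF : #F ≤ c) (hFZ : F ∉ KZ) :
    TcForm c (K.erase F) KZ = TcForm c K KZ + ee c * monomial (ind F) 1 * gf (facesLE c KZ) := by
  obtain ⟨h1, h2⟩ := facesLE_erase_small hFK hF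
  obtain ⟨h3, h4⟩ := commonFamilies_erase_of_notMem' (c := c) (K := K) hFZ
  have hgf : gf (facesLE c K) = gf (facesLE c (K.erase F)) + monomial (ind F) 1 := by
    rw [h1]; unfold gf; rw [sum_erase_add _ _ h2]
  unfold TcForm
  rw [h3, h4, hgf]
  ring

/-- Hence `T_c(K_X, K_Z) ≤ T_c(K_X∖F, K_Z)` coefficientwise for a private small face `F` (`K_Z` any family). [this work] -/
theorem coeff_TcForm_le_erase_private {c : ℕ} {K KZ : Finset (Finset α)} {F : Finset α} (hFK : F ∈ K) (hF : #F ≤ c) (hFZ : F ∉ KZ)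
    (n : α →₀ ℕ) : (TcForm c K KZ).coeff n ≤ (TcForm c (K.erase F) KZ).coeff n := by
  obtain ⟨-, hec, -, -⟩ := coeff_PiP_ee_nonneg (α := α) c
  rw [TcForm_erase_private hFK hF hFZ, mul_assoc, coeff_add]
  have := coeff_mul_nonneg hec (coeff_monomial_mul_nonneg F (coeff_gf_nonneg (facesLE c KZ))) n
  linarith

/-! ### Common faces below the top level: removal lowers `T_c` -/

/-- Removing a common face of size `< c` from `K_X`: `h_Y` loses `F`, `e_Y` is unchanged. [this work] -/
theorem commonFamilies_erase_common_lt {c : ℕ} {K KZ : Finset (Finset α)} {F : Finset α} (hFK : F ∈ K) (hF : #F < c) (hFZ : F ∈ KZ) :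
    commonLE c (K.erase F) KZ = (commonLE c K KZ).erase F ∧ F ∈ commonLE c K KZ ∧ commonEQ c (K.erase F) KZ = commonEQ c K KZ := by
  refine ⟨?_, mem_filter.2 ⟨mem_powerset.2 (subset_univ _), by omega, hFK, hFZ⟩, ?_⟩
  · ext T; simp only [commonLE, mem_filter, mem_erase, ne_eq]; tauto
  · ext T; simp only [commonEQ, mem_filter, mem_erase, ne_eq]
    constructor
    · rintro ⟨h1, h2, ⟨_, h3⟩, h4⟩; exact ⟨h1, h2, h3, h4⟩
    · rintro ⟨h1, h2, h3, h4⟩; exact ⟨h1, h2, ⟨by rintro rfl; omega, h3⟩, h4⟩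

/-- **Common sub-top move**: for `F ∈ K_X ∩ K_Z` with `#F < c`, `T_c(K_X∖F, K_Z) = T_c(K_X, K_Z) − e_c·r^F·(Π − h_Z)`. [this work] -/
theorem TcForm_erase_common_lt {c : ℕ} {K KZ : Finset (Finset α)} {F : Finset α} (hFK : F ∈ K) (hF : #F < c) (hFZ : F ∈ KZ) :
    TcForm c (K.erase F) KZ = TcForm c K KZ - ee c * monomial (ind F) 1 * (PiP - gf (facesLE c KZ)) := by
  obtain ⟨h1, h2⟩ := facesLE_erase_small hFK hF.le
  obtain ⟨h3, h3', h4⟩ := commonFamilies_erase_common_lt (c := c) hFK hF hFZ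
  have hgf : gf (facesLE c K) = gf (facesLE c (K.erase F)) + monomial (ind F) 1 := by
    rw [h1]; unfold gf; rw [sum_erase_add _ _ h2]
  have hgy : gf (commonLE c K KZ) = gf (commonLE c (K.erase F) KZ) + monomial (ind F) 1 := by
    rw [h3]; unfold gf; rw [sum_erase_add _ _ h3']
  unfold TcForm
  rw [h4, hgf, hgy]
  ring

/-- `Π − h_Z` has nonnegative coefficients (it is the generating function of the complement family). [this work] -/
theorem coeff_PiP_sub_facesLE_nonneg (c : ℕ) (KZ : Finset (Finset α)) (n : α →₀ ℕ) :
    0 ≤ (PiP - gf (facesLE c KZ) : MvPolynomial α ℤ).coeff n := by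
  have h : (PiP - gf (facesLE c KZ) : MvPolynomial α ℤ) = DdC c + gf (univ.powerset.filter fun S : Finset α => #S ≤ c ∧ S ∉ KZ) := by
    rw [PiP_eq_facesLE_add c KZ]; ring
  rw [h]
  exact cw_add (coeff_PiP_ee_nonneg (α := α) c).2.2.2 (coeff_gf_nonneg _) n

/-- Hence `T_c(K_X∖F, K_Z) ≤ T_c(K_X, K_Z)` coefficientwise for a common face `F` of size `< c`: **to prove `T_c(K_X,K_Z) ∈ ℕ[r]` it suffices
to prove it after deleting such faces from `K_X`** (and, by the symmetry of `T_c`, from `K_Z`). [this work] -/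
theorem coeff_TcForm_erase_common_lt_le {c : ℕ} {K KZ : Finset (Finset α)} {F : Finset α} (hFK : F ∈ K) (hF : #F < c) (hFZ : F ∈ KZ)
    (n : α →₀ ℕ) : (TcForm c (K.erase F) KZ).coeff n ≤ (TcForm c K KZ).coeff n := by
  obtain ⟨-, hec, -, -⟩ := coeff_PiP_ee_nonneg (α := α) c
  rw [TcForm_erase_common_lt hFK hF hFZ, mul_assoc, coeff_sub]
  have := coeff_mul_nonneg hec (coeff_monomial_mul_nonneg F (coeff_PiP_sub_facesLE_nonneg c KZ)) n
  linarith

/-- The inductive form: if `T_c(K_X∖F, K_Z) ∈ ℕ[r]` for a common face `F ∈ K_X` of size `< c`, then `T_c(K_X, K_Z) ∈ ℕ[r]`. [this work] -/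
theorem coeff_TcForm_nonneg_of_erase_common_lt {c : ℕ} {K KZ : Finset (Finset α)} {F : Finset α} (hFK : F ∈ K) (hF : #F < c)
    (hFZ : F ∈ KZ) (h : ∀ n, 0 ≤ (TcForm c (K.erase F) KZ).coeff n) : ∀ n, 0 ≤ (TcForm c K KZ).coeff n :=
  fun n => (h n).trans (coeff_TcForm_erase_common_lt_le hFK hF hFZ n)

end Summit.CriticalPhenomena.PercolationContinuityZ3.Theorems.SahiCTCForms
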